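import Mathlib
import Summits.ValiantsHypothesis.ValiantsHypothesis.Theses.ValuativeGCT
import Summits.ValiantsHypothesis.ValiantsHypothesis.Theorems.ValuativeGCTValuativeFlipInnerMonotone
import Summits.ValiantsHypothesis.ValiantsHypothesis.Theorems.ValuativeGCTValuativeFlipTailSuffices
import Summits.ValiantsHypothesis.ValiantsHypothesis.Theorems.ValuativeGCTValuativeBound
import Summits.ValiantsHypothesis.ValiantsHypothesis.Theorems.ValuativeGCTGctMultPrinciple

/-!
# Border determinantal complexity of the permanent is monotone in `n`; the crux in `dc̲` currency —
# size-transfer axis, part V b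

Companion to `…ValuativeFlipBorderPaddingMonotone` (wall-breaker k12 seat 4, 2026-08-16: membership
`HasBorderDetRepr ℂ n m : X₀₀^{m-n} per_n ∈ Δ(det_m)` is monotone in the level `m`, `dc̲(per_n)` is a threshold,
`VP ≠ VNP` follows from `W_c(n) < dc̲(per_n)` eventually).  This file records the transfers of membership that do
NOT need the level monotonicity, so that it builds over part I only:

* `hasBorderDetRepr_anti_inner` — membership is ANTITONE in the inner size at fixed level: for `n ≤ n' ≤ m`,
  `X₀₀^{m-n'} per_{n'} ∈ Δ(det_m) ⇒ X₀₀^{m-n} per_n ∈ Δ(det_m)` (the inner degeneration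
  `paddedPerFormLex_mem_orbitClosure_of_le` of part I);
* `borderDetComplexityPer_mono` — hence **`dc̲(per_n)` is monotone in `n`** (membership at `(n', dc̲(per_{n'}))`
  descends to `(n, dc̲(per_{n'}))`; no level monotonicity needed);
* `window_lt_borderDetComplexityPer_of_valuativeFlip` — **the crux in border-complexity currency**:
  `ValuativeFlip → ∀ c, ∃ n₀, ∀ n ≥ n₀, W_c(n) = 2^((log₂ n + c)^c) < dc̲(per_n)`: the crux flips at EVERY level
  `n ≤ m ≤ W_c(n)`, each flip forbids membership there (`ValuativeBound` + the multiplicity-obstruction principle),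
  and `n ≤ dc̲(per_n)`; so `dc̲(per_n)` lies above the whole window.  Same from `TailFlip`
  (`tailFlip_iff_valuativeFlip`).  The converse direction `(∀ c, eventually W_c(n) < dc̲(per_n)) → ValiantsHypothesis`
  is part V's `valiantsHypothesis_of_window_lt_borderDetComplexityPer` (that one needs the level monotonicity).

[Mulmuley–Sohoni 2001 §4; Landsberg 2017 §6; Bürgisser–Ikenmeyer–Panova 2019 §1(a); this crux]
-/

set_option linter.dupNamespace false

namespace Summit.ValiantsHypothesis.ValiantsHypothesis.Theorems.ValuativeFlip

open scoped BigOperators Matrix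
open MvPolynomial
open Literature.NumberTheory.DiophantineGeometry
open Literature.Computability.AlgebraicComplexity
open Summit.ValiantsHypothesis.ValiantsHypothesis.Theses.ValuativeGCT

noncomputable section

/-! ## Membership is antitone in the inner size; `dc̲(per_n)` is monotone in `n` -/

/-- **Membership is antitone in the inner size**: for `n ≤ n' ≤ m`,
`X₀₀^{m-n'} per_{n'} ∈ Δ(det_m) ⇒ X₀₀^{m-n} per_n ∈ Δ(det_m)` (the smaller padded permanent is a degeneration of
the larger one at the same level, `paddedPerFormLex_mem_orbitClosure_of_le`; transport to `paddedPerPoly` by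
`hasBorderDetRepr_iff_rename`). [Bürgisser–Ikenmeyer–Panova 2019 §1(a); this crux part I] -/
theorem hasBorderDetRepr_anti_inner {n n' m : ℕ} [NeZero m] (hnn' : n ≤ n') (hn'm : n' ≤ m)
    (h : HasBorderDetRepr ℂ n' m) : HasBorderDetRepr ℂ n m :=
  (hasBorderDetRepr_iff_rename_holds (k := ℂ) n m).2
    (orbitClosure_subset_of_mem_holds ((hasBorderDetRepr_iff_rename_holds (k := ℂ) n' m).1 h)
      (paddedPerFormLex_mem_orbitClosure_of_le hnn' hn'm))

/-- **`dc̲(per_n)` is monotone in `n`**: for `n ≤ n'`, `dc̲(per_n) ≤ dc̲(per_{n'})` — membership at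
`(n', dc̲(per_{n'}))` (the infimum is attained, `hasBorderDetRepr_borderDetComplexityPer`) descends to
`(n, dc̲(per_{n'}))`, which lies in the defining set of `dc̲(per_n)`. [Mulmuley–Sohoni 2001 §4; folklore] -/
theorem borderDetComplexityPer_mono {n n' : ℕ} (hnn' : n ≤ n') :
    borderDetComplexityPer ℂ n ≤ borderDetComplexityPer ℂ n' := by
  obtain ⟨hpos, hle, hmem⟩ := hasBorderDetRepr_borderDetComplexityPer (k := ℂ) n'
  haveI : NeZero (borderDetComplexityPer ℂ n') := NeZero.of_pos hpos
  exact Nat.sInf_le ⟨hpos, hnn'.trans hle, hasBorderDetRepr_anti_inner hnn' hle hmem⟩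

/-! ## The crux in `dc̲` currency -/

/-- **A flip forbids membership at its own position**: if the body of `ValuativeFlip` holds at `(n, m)`,
`n ≤ m`, then `X₀₀^{m-n} per_n ∉ Δ(det_m)` (`ValuativeBound`: `K_m(λ*) ≤ dim T_U(λ)`, then the
multiplicity-obstruction principle `GctMultPrinciple`). [this route] -/
theorem not_hasBorderDetRepr_of_flipBody {n m : ℕ} [NeZero m] (hnm : n ≤ m)
    (h :
      ∃ (U : Submodule ℂ (MatIdx m → ℂ)) (r δ : ℕ) (lam : Nat.Partition (m * δ)),
            (∀ u ∈ U, (Matrix.of fun a b : Fin m => u (toLex (a, b))).rank ≤ r) ∧ lam.parts.card ≤ m * m ∧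
              Module.finrank ℂ ↥(MvPolynomial.homogeneousSubmodule (MatIdx m × MatIdx m) ℂ (m * δ) ⊓
                  ((MvPolynomial.vanishingIdeal ℂ
                      {p : MatIdx m × MatIdx m → ℂ | ∀ j : MatIdx m, (fun i => p (j, i)) ∈ U}) ^ (δ * (m - r))).restrictScalars ℂ ⊓
                  (⨅ (M : Matrix (MatIdx m) (MatIdx m) ℂ)
                    (_ : linSubst (MatIdx m) ℂ M (detFormLex ℂ m) = detFormLex ℂ m),
                    LinearMap.ker ((MvPolynomial.aeval fun p : MatIdx m × MatIdx m =>
                        ∑ l : MatIdx m, M l p.2 •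
                          (MvPolynomial.X (p.1, l) : MvPolynomial (MatIdx m × MatIdx m) ℂ)).toLinearMap -
                      (LinearMap.id : MvPolynomial (MatIdx m × MatIdx m) ℂ →ₗ[ℂ] MvPolynomial (MatIdx m × MatIdx m) ℂ))) ⊓
                  (⨅ (g : Matrix.GeneralLinearGroup (MatIdx m) ℂ) (_ : IsUpperTriangular g),
                    LinearMap.ker ((MvPolynomial.aeval fun p : MatIdx m × MatIdx m =>
                        ∑ l : MatIdx m, ((g⁻¹ : Matrix.GeneralLinearGroup (MatIdx m) ℂ) :
                          Matrix (MatIdx m) (MatIdx m) ℂ) p.1 l •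
                            (MvPolynomial.X (l, p.2) : MvPolynomial (MatIdx m × MatIdx m) ℂ)).toLinearMap -
                      weightChar ((Weight.dualOfPartition (m * m) lam).toMatIdx : Weight (MatIdx m)) g •
                        (LinearMap.id : MvPolynomial (MatIdx m × MatIdx m) ℂ →ₗ[ℂ] MvPolynomial (MatIdx m × MatIdx m) ℂ)))) <
                orbitMultiplicity ℂ (paddedPerFormLex ℂ n m) m
                  ((Weight.dualOfPartition (m * m) lam).toMatIdx : Weight (MatIdx m))) :
    ¬ HasBorderDetRepr ℂ n m := by
  obtain ⟨U, r, δ, lam, hU, hcard, hlt⟩ := h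
  exact GctMultPrinciple_proof n m _ hnm
    (lt_of_le_of_lt (ValuativeBound.ValuativeBound_proof m U r hU δ lam hcard) hlt)

/-- **The crux in border-complexity currency.**  `ValuativeFlip` implies: for every `c`, for all large `n`,
`W_c(n) = 2^((log₂ n + c)^c) < dc̲(per_n)`.  Proof without level monotonicity: `n ≤ dc̲(per_n)`
(`le_borderDetComplexityPer`), and if `dc̲(per_n) ≤ W_c(n)` then `(n, dc̲(per_n))` is a window position, where the
crux flips and forbids the membership that defines `dc̲(per_n)` (`hasBorderDetRepr_borderDetComplexityPer`).
[this crux; Mulmuley–Sohoni 2001 §4] -/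
theorem window_lt_borderDetComplexityPer_of_valuativeFlip (hV : ValuativeFlip) :
    ∀ c : ℕ, ∃ n₀ : ℕ, ∀ n ≥ n₀, 2 ^ ((Nat.log 2 n + c) ^ c) < borderDetComplexityPer ℂ n := by
  intro c
  obtain ⟨n₀, hn₀⟩ := hV c
  refine ⟨n₀, fun n hn => ?_⟩
  by_contra hge
  rw [not_lt] at hge
  obtain ⟨hpos, hle, hmem⟩ := hasBorderDetRepr_borderDetComplexityPer (k := ℂ) n
  haveI : NeZero (borderDetComplexityPer ℂ n) := NeZero.of_pos hpos
  exact not_hasBorderDetRepr_of_flipBody hle (hn₀ n hn (borderDetComplexityPer ℂ n) hle hge) hmem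

/-- The same from the tail child: `TailFlip → ∀ c, eventually W_c(n) < dc̲(per_n)`
(`tailFlip_iff_valuativeFlip`, k16). [this crux] -/
theorem window_lt_borderDetComplexityPer_of_tailFlip (hT : TailFlip) :
    ∀ c : ℕ, ∃ n₀ : ℕ, ∀ n ≥ n₀, 2 ^ ((Nat.log 2 n + c) ^ c) < borderDetComplexityPer ℂ n :=
  window_lt_borderDetComplexityPer_of_valuativeFlip (tailFlip_iff_valuativeFlip.mp hT)

/-- **`dc̲(per_n)` is super-quasi-polynomial along a window-syndetic set of `n` already under the crux
restricted there** — bookkeeping instance: from `ValuativeFlip`, for every `c` and all large `k`,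
`2^((k + c)^c) < dc̲(per_{2^k})` (`log₂ 2^k = k`). [this crux] -/
theorem powTwo_window_lt_borderDetComplexityPer_of_valuativeFlip (hV : ValuativeFlip) (c : ℕ) :
    ∃ k₀ : ℕ, ∀ k ≥ k₀, 2 ^ ((k + c) ^ c) < borderDetComplexityPer ℂ (2 ^ k) := by
  obtain ⟨n₀, hn₀⟩ := window_lt_borderDetComplexityPer_of_valuativeFlip hV c
  refine ⟨n₀, fun k hk => ?_⟩
  have h := hn₀ (2 ^ k) (hk.trans (Nat.lt_two_pow_self).le)
  rwa [Nat.log_pow (by norm_num)] at h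

end

end Summit.ValiantsHypothesis.ValiantsHypothesis.Theorems.ValuativeFlip
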